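import Summits.CriticalPhenomena.PercolationContinuityZ3.Theorems.SahiBoxTP2SetConfigurations
import Summits.CriticalPhenomena.PercolationContinuityZ3.Theorems.SahiBoxTP2PositiveAssociation
import Literature.Probability.LatticeModels.RandomClusterInfiniteVolume
import Literature.Probability.LatticeModels.RandomClusterFKG
import Literature.Probability.Percolation.PercolationProofs

/-!
# The limit random-cluster measures `φ⁰_{p,q}`, `φ¹_{p,q}` of `ℤ^d` (`q ≥ 1`) are box-TP₂: FKG for ALL measurable
# monotone functionals, and Sahi positivity of every order given `C_n`

Support file of the Sahi cell (`prim-sahi`, typer seat, generation 16; `--supports stmt-CriticalPhenomena-4575`).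
Theorems only (no definitions, no named facts, no sorries).  The bond / FK analogue of generation 13's
`SahiIsingGibbsStates.lean` (infinite-volume Ising states are box-TP₂), for the tree's infinite-volume random-cluster
vocabulary `Literature.Probability.LatticeModels.IsRandomClusterLimit d b p q P` ("`P` is the limit `φ^b_{p,q}` of the
box measures `φ^b_{Λ_n,p,q}` on local events", Grimmett 2006 Thm. (4.19)(a); `RandomClusterInfiniteVolume.lean`, whose
EXISTENCE half is not in the tree — every statement here is about ANY measure with that property, exactly as the
generation-13 Ising theorems are about any measure with the `±` correlations).

* `rcMeasure_real_mul_le` — **the lattice inequality for EVENTS of a finite-volume random-cluster measure** (any finite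
  graph, `0 ≤ p ≤ 1`, `q ≥ 1`, any wired set): if `s ∩ t ∈ S'` and `s ∪ t ∈ T'` whenever `s ∈ S`, `t ∈ T`, then
  `φ(S) φ(T) ≤ φ(S') φ(T')` (the FKG lattice condition of the weights, tree `rcWeight_lattice_condition`
  [Grimmett 2006, Thm. 3.8 (3.11)], and the four functions theorem); `isBoxTP2_rcMeasure`: **`φ^B_{G,p,q}` is box-TP₂**
  (boxes `{ω | a ⊆ ω ⊆ b}`); `rcMeasure_fkg_setCylinders`: FKG-lattice CYLINDER probabilities.
* `rcLaw_real_mul_le`, `rcLaw_fkg_setCylinders` — the same for the finite-region measures `φ^W_{Λ,p,q}` read on `ℤ^d`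
  (`toLattice` is an injective lattice embedding).
* `isRandomClusterLimit_fkg_setCylinders`, **`isRandomClusterLimit_isBoxTP2`** — cylinders are local events, so the
  cylinder inequalities pass to the limit `P = φ^b_{p,q}`; by generation 12's `isBoxTP2_of_fkg_setCylinders`,
  **every limit random-cluster measure `φ^b_{p,q}` on `ℤ^d` (`b` free or wired, `0 ≤ p ≤ 1`, `q ≥ 1`) is box-TP₂**.
* CONSEQUENCES for `P = φ^b_{p,q}`: `isRandomClusterLimit_integral_mul_integral_le` — **the FKG inequality for ALL
  measurable nonnegative monotone functionals of the infinite configuration** (not only local / quasilocal ones: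
  `{x ↔ ∞}`, `{x ↔ y}`, existence of an infinite cluster, …); `isRandomClusterLimit_measure_mul_le_inter` (increasing
  events), `isRandomClusterLimit_isPositivelyAssociated` (the tree's `IsPositivelyAssociated`),
  `isRandomClusterLimit_percolatesAt_mul_le` (`φ(x ↔ ∞) φ(y ↔ ∞) ≤ φ(x ↔ ∞, y ↔ ∞)`);
  **`isRandomClusterLimit_msahiE_nonneg` (+ `_antitone`, `_of_sahiConjecture`): GIVEN `C_n` (⟺ `∀ d, LiebSahiContinuum d n`),
  `E_n(f_0,…,f_{n−1}) ≥ 0` for all measurable nonnegative monotone functionals** — Sahi positivity of every order for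
  the infinite-volume FK measures, in particular FK–Ising `q = 2`.

In print: FKG / positive association of `φ^b_{p,q}` for increasing (quasi)local or continuous functions [Grimmett 2006,
Thm. (4.17)(c), (4.19)] via weak limits; the density-free box-TP₂ property of the limit measures, the extension to all
measurable monotone functionals without couplings, and the `E_n` statements are this work.

No sorries, no new axioms.
-/

noncomputable section

namespace Summit.CriticalPhenomena.PercolationContinuityZ3.Theorems.SahiBoxTP2

open MeasureTheory Set Filter Topology Function Finset
open Literature.Probability.LatticeModels Literature.Probability.Percolation Literature.Combinatorics.Sahi2008
open scoped ENNReal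

/-! ### Finite graphs: the lattice inequality for events of `φ^B_{G,p,q}` -/

section FiniteGraph

variable {V : Type*} [Fintype V] [DecidableEq V] (G : SimpleGraph V) [DecidableRel G.Adj]

/-- The random-cluster measure of an event as a sum of the zero-extended weights over a filter of ALL edge sets.
[folklore] -/
theorem rcMeasure_real_eq_sum_filter {p q : ℝ} (hp : p ∈ Set.Icc (0 : ℝ) 1) (hq : 0 < q) (B : Set V)
    (X : Set (BondConfig V)) [DecidablePred fun ω : Finset (Sym2 V) => (↑ω : BondConfig V) ∈ X] :
    (rcMeasure G p q B).real X =
      (∑ ω ∈ Finset.univ.filter (fun ω : Finset (Sym2 V) => (↑ω : BondConfig V) ∈ X),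
        (if ω ⊆ G.edgeFinset then rcWeight G p q B ω else 0)) / rcPartitionFunction G p q B := by
  classical
  rw [rcMeasure_real_apply G hp hq B X, Finset.sum_filter, Finset.sum_div]
  have hfilter : (Finset.univ : Finset (Finset (Sym2 V))).filter (· ⊆ G.edgeFinset) = G.edgeFinset.powerset := by
    ext ω; simp
  rw [← hfilter, Finset.sum_filter]
  refine Finset.sum_congr rfl fun ω _ => ?_
  by_cases h1 : ω ⊆ G.edgeFinset <;> by_cases h2 : (↑ω : BondConfig V) ∈ X <;> simp [h1, h2]

open scoped FinsetFamily in
/-- **The lattice inequality for events of a finite-volume random-cluster measure** (`0 ≤ p ≤ 1`, `q ≥ 1`, any wired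
set `B`): if `s ∩ t ∈ S'` and `s ∪ t ∈ T'` for all `s ∈ S`, `t ∈ T`, then `φ(S) φ(T) ≤ φ(S') φ(T')`.
[this work; cite: Grimmett2006, Thm. 3.8 (3.11) (lattice condition of the weights)] -/
theorem rcMeasure_real_mul_le {p q : ℝ} (hp : p ∈ Set.Icc (0 : ℝ) 1) (hq : 1 ≤ q) (B : Set V)
    (S T S' T' : Set (BondConfig V)) (hinf : ∀ s ∈ S, ∀ t ∈ T, s ∩ t ∈ S')
    (hsup : ∀ s ∈ S, ∀ t ∈ T, s ∪ t ∈ T') :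
    (rcMeasure G p q B).real S * (rcMeasure G p q B).real T ≤
      (rcMeasure G p q B).real S' * (rcMeasure G p q B).real T' := by
  classical
  have hq0 : 0 < q := one_pos.trans_le hq
  have hZ := rcPartitionFunction_pos G hp hq0 B
  set w : Finset (Sym2 V) → ℝ := fun ω => if ω ⊆ G.edgeFinset then rcWeight G p q B ω else 0 with hw
  have hw0 : 0 ≤ w := fun ω => rcWeight_ite_nonneg G hp hq0.le B ω
  set F : Set (BondConfig V) → Finset (Finset (Sym2 V)) :=
    fun X => Finset.univ.filter fun ω : Finset (Sym2 V) => (↑ω : BondConfig V) ∈ X with hF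
  have hreal : ∀ X : Set (BondConfig V), (rcMeasure G p q B).real X = (∑ ω ∈ F X, w ω) / rcPartitionFunction G p q B :=
    fun X => rcMeasure_real_eq_sum_filter G hp hq0 B X
  rw [hreal S, hreal T, hreal S', hreal T', div_mul_div_comm, div_mul_div_comm]
  refine div_le_div_of_nonneg_right ?_ (mul_pos hZ hZ).le
  have h4 := four_functions_theorem w w w w hw0 hw0 hw0 hw0 (fun a b => rcWeight_lattice_condition G hp hq B a b)
    (F S) (F T)
  have hinfs : F S ⊼ F T ⊆ F S' := by
    intro c hc
    rw [Finset.mem_infs] at hc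
    obtain ⟨a, ha, b, hb, rfl⟩ := hc
    simp only [hF, Finset.mem_filter, Finset.mem_univ, true_and] at ha hb ⊢
    rw [Finset.inf_eq_inter, Finset.coe_inter]
    exact hinf _ ha _ hb
  have hsups : F S ⊻ F T ⊆ F T' := by
    intro c hc
    rw [Finset.mem_sups] at hc
    obtain ⟨a, ha, b, hb, rfl⟩ := hc
    simp only [hF, Finset.mem_filter, Finset.mem_univ, true_and] at ha hb ⊢
    rw [Finset.sup_eq_union, Finset.coe_union]
    exact hsup _ ha _ hb
  calc (∑ ω ∈ F S, w ω) * ∑ ω ∈ F T, w ω ≤ (∑ ω ∈ F S ⊼ F T, w ω) * ∑ ω ∈ F S ⊻ F T, w ω := h4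
    _ ≤ (∑ ω ∈ F S', w ω) * ∑ ω ∈ F T', w ω :=
        mul_le_mul (Finset.sum_le_sum_of_subset_of_nonneg hinfs fun ω _ _ => hw0 ω)
          (Finset.sum_le_sum_of_subset_of_nonneg hsups fun ω _ _ => hw0 ω)
          (Finset.sum_nonneg fun ω _ => hw0 ω) (Finset.sum_nonneg fun ω _ => hw0 ω)

/-- From the real form to the `ℝ≥0∞` form for a finite measure (plumbing). [folklore] -/
theorem measure_mul_le_of_real_mul_le {Ω : Type*} [MeasurableSpace Ω] (μ : Measure Ω) [IsFiniteMeasure μ]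
    {S T S' T' : Set Ω} (h : μ.real S * μ.real T ≤ μ.real S' * μ.real T') : μ S * μ T ≤ μ S' * μ T' := by
  rw [← ofReal_measureReal (measure_ne_top μ S), ← ofReal_measureReal (measure_ne_top μ T),
    ← ofReal_measureReal (measure_ne_top μ S'), ← ofReal_measureReal (measure_ne_top μ T'),
    ← ENNReal.ofReal_mul measureReal_nonneg, ← ENNReal.ofReal_mul measureReal_nonneg]
  exact ENNReal.ofReal_le_ofReal h

/-- **The finite-volume random-cluster measure `φ^B_{G,p,q}` is box-TP₂** (`0 ≤ p ≤ 1`, `q ≥ 1`): for the order boxes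
`[a,b] = {ω | a ⊆ ω ⊆ b}` of `Set (Sym2 V)`, `φ[a,b] φ[a',b'] ≤ φ[a ∩ a', b ∩ b'] φ[a ∪ a', b ∪ b']`. [this work] -/
theorem isBoxTP2_rcMeasure {p q : ℝ} (hp : p ∈ Set.Icc (0 : ℝ) 1) (hq : 1 ≤ q) (B : Set V) :
    IsBoxTP2 (rcMeasure G p q B) := by
  haveI := isProbabilityMeasure_rcMeasure G hp (one_pos.trans_le hq) B
  intro a b a' b'
  refine measure_mul_le_of_real_mul_le _ (rcMeasure_real_mul_le G hp hq B _ _ _ _ ?_ ?_)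
  · intro s hs t ht
    exact ⟨subset_inter (inter_subset_left.trans hs.1) (inter_subset_right.trans ht.1), inter_subset_inter hs.2 ht.2⟩
  · intro s hs t ht
    exact ⟨union_subset_union hs.1 ht.1, union_subset (hs.2.trans subset_union_left) (ht.2.trans subset_union_right)⟩

/-- Cylinder patterns are stable under `∩`. [folklore] -/
theorem inter_inter_eq_of_cylinder {ι : Type*} {J A B : Set ι} {s t : Set ι} (hs : s ∩ J = A ∩ J) (ht : t ∩ J = B ∩ J) :
    s ∩ t ∩ J = A ∩ B ∩ J := by
  rw [show s ∩ t ∩ J = (s ∩ J) ∩ (t ∩ J) by ext x; simp only [mem_inter_iff]; tauto, hs, ht]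
  ext x; simp only [mem_inter_iff]; tauto

/-- Cylinder patterns are stable under `∪`. [folklore] -/
theorem union_inter_eq_of_cylinder {ι : Type*} {J A B : Set ι} {s t : Set ι} (hs : s ∩ J = A ∩ J) (ht : t ∩ J = B ∩ J) :
    (s ∪ t) ∩ J = (A ∪ B) ∩ J := by
  rw [union_inter_distrib_right, hs, ht, ← union_inter_distrib_right]

/-- **FKG-lattice cylinder probabilities of `φ^B_{G,p,q}`** (`q ≥ 1`). [this work] -/
theorem rcMeasure_fkg_setCylinders {p q : ℝ} (hp : p ∈ Set.Icc (0 : ℝ) 1) (hq : 1 ≤ q) (B : Set V)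
    (J : Finset (Sym2 V)) (A A' : Set (Sym2 V)) :
    (rcMeasure G p q B).real {x | x ∩ ↑J = A ∩ ↑J} * (rcMeasure G p q B).real {x | x ∩ ↑J = A' ∩ ↑J} ≤
      (rcMeasure G p q B).real {x | x ∩ ↑J = (A ∩ A') ∩ ↑J} *
        (rcMeasure G p q B).real {x | x ∩ ↑J = (A ∪ A') ∩ ↑J} :=
  rcMeasure_real_mul_le G hp hq B _ _ _ _ (fun _ hs _ ht => inter_inter_eq_of_cylinder hs ht)
    fun _ hs _ ht => union_inter_eq_of_cylinder hs ht

end FiniteGraph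

/-! ### Finite regions of `ℤ^d` read on the lattice -/

section Lattice

variable {d : ℕ}

/-- Order boxes `{x | a ⊆ x ⊆ b}` of `Set ι` (`ι` countable) are measurable. [folklore] -/
theorem measurableSet_Icc_set {ι : Type*} [Countable ι] (a b : Set ι) : MeasurableSet (Icc a b) := by
  have e : Icc a b = (⋂ i ∈ a, {x : Set ι | i ∈ x}) ∩ ⋂ i ∈ bᶜ, {x : Set ι | i ∉ x} := by
    ext x
    simp only [Set.mem_Icc, Set.mem_inter_iff, Set.mem_iInter, Set.mem_setOf_eq, Set.mem_compl_iff]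
    exact ⟨fun ⟨h1, h2⟩ => ⟨fun i hi => h1 hi, fun i hi hx => hi (h2 hx)⟩,
      fun ⟨h1, h2⟩ => ⟨fun i hi => h1 i hi, fun i hx => by_contra fun hi => h2 i hi hx⟩⟩
  rw [e]
  exact (MeasurableSet.biInter (to_countable a) fun i _ => measurableSet_mem i).inter
    (MeasurableSet.biInter (to_countable _) fun i _ => measurableSet_notMem i)

/-- `toLattice` commutes with `∩` (injective image). [folklore] -/
theorem toLattice_inter (Λ : Finset (Site d)) (s t : BondConfig ↥Λ) :
    toLattice Λ (s ∩ t) = toLattice Λ s ∩ toLattice Λ t :=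
  Set.image_inter (Sym2.map.injective Subtype.val_injective)

/-- `toLattice` commutes with `∪`. [folklore] -/
theorem toLattice_union (Λ : Finset (Site d)) (s t : BondConfig ↥Λ) :
    toLattice Λ (s ∪ t) = toLattice Λ s ∪ toLattice Λ t :=
  Set.image_union _ s t

/-- **The lattice inequality for events of `φ^W_{Λ,p,q}` read on `ℤ^d`** (`0 ≤ p ≤ 1`, `q ≥ 1`; measurable events).
[this work] -/
theorem rcLaw_real_mul_le {p q : ℝ} (hp : p ∈ Set.Icc (0 : ℝ) 1) (hq : 1 ≤ q) (Λ : Finset (Site d)) (W : Set ↥Λ)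
    {S T S' T' : Set (BondConfig (Site d))} (hSm : MeasurableSet S) (hTm : MeasurableSet T)
    (hS'm : MeasurableSet S') (hT'm : MeasurableSet T') (hinf : ∀ s ∈ S, ∀ t ∈ T, s ∩ t ∈ S')
    (hsup : ∀ s ∈ S, ∀ t ∈ T, s ∪ t ∈ T') :
    (rcLaw d p q Λ W).real S * (rcLaw d p q Λ W).real T ≤ (rcLaw d p q Λ W).real S' * (rcLaw d p q Λ W).real T' := by
  classical
  rw [rcLaw_real_apply p q Λ W hSm, rcLaw_real_apply p q Λ W hTm, rcLaw_real_apply p q Λ W hS'm,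
    rcLaw_real_apply p q Λ W hT'm]
  refine rcMeasure_real_mul_le _ hp hq W _ _ _ _ (fun s hs t ht => ?_) fun s hs t ht => ?_
  · change toLattice Λ (s ∩ t) ∈ S'
    rw [toLattice_inter]
    exact hinf _ hs _ ht
  · change toLattice Λ (s ∪ t) ∈ T'
    rw [toLattice_union]
    exact hsup _ hs _ ht

/-- **FKG-lattice cylinder probabilities of `φ^W_{Λ,p,q}` read on `ℤ^d`** (`q ≥ 1`). [this work] -/
theorem rcLaw_fkg_setCylinders {p q : ℝ} (hp : p ∈ Set.Icc (0 : ℝ) 1) (hq : 1 ≤ q) (Λ : Finset (Site d)) (W : Set ↥Λ)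
    (J : Finset (Sym2 (Site d))) (A B : Set (Sym2 (Site d))) :
    (rcLaw d p q Λ W).real {x | x ∩ ↑J = A ∩ ↑J} * (rcLaw d p q Λ W).real {x | x ∩ ↑J = B ∩ ↑J} ≤
      (rcLaw d p q Λ W).real {x | x ∩ ↑J = (A ∩ B) ∩ ↑J} * (rcLaw d p q Λ W).real {x | x ∩ ↑J = (A ∪ B) ∩ ↑J} :=
  rcLaw_real_mul_le hp hq Λ W (measurableSet_setCylinder J A) (measurableSet_setCylinder J B)
    (measurableSet_setCylinder J _) (measurableSet_setCylinder J _) (fun _ hs _ ht => inter_inter_eq_of_cylinder hs ht)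
    fun _ hs _ ht => union_inter_eq_of_cylinder hs ht

/-- **`φ^W_{Λ,p,q}` read on `ℤ^d` is box-TP₂** (`q ≥ 1`). [this work] -/
theorem isBoxTP2_rcLaw {p q : ℝ} (hp : p ∈ Set.Icc (0 : ℝ) 1) (hq : 1 ≤ q) (Λ : Finset (Site d)) (W : Set ↥Λ) :
    IsBoxTP2 (rcLaw d p q Λ W) := by
  haveI := isProbabilityMeasure_rcLaw (d := d) hp (one_pos.trans_le hq) Λ W
  intro a b a' b'
  refine measure_mul_le_of_real_mul_le _ (rcLaw_real_mul_le hp hq Λ W (measurableSet_Icc_set a b)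
    (measurableSet_Icc_set a' b') (measurableSet_Icc_set _ _) (measurableSet_Icc_set _ _)
    ?_ ?_)
  · intro s hs t ht
    exact ⟨subset_inter (inter_subset_left.trans hs.1) (inter_subset_right.trans ht.1), inter_subset_inter hs.2 ht.2⟩
  · intro s hs t ht
    exact ⟨union_subset_union hs.1 ht.1, union_subset (hs.2.trans subset_union_left) (ht.2.trans subset_union_right)⟩

/-- A set cylinder `{x | x ∩ J = A ∩ J}` is a local event. [folklore] -/
theorem isLocalEvent_setCylinder {ι : Type*} (J : Finset ι) (A : Set ι) : IsLocalEvent {x : Set ι | x ∩ ↑J = A ∩ ↑J} :=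
  ⟨J, (determinedBy_iff _ _).2 fun ω ω' h => by simp only [mem_setOf_eq, h]⟩

end Lattice

/-! ### The limit measures `φ^b_{p,q}` -/


section Limit

variable {d : ℕ} {b : RCBoundary} {p q : ℝ} {P : Measure (BondConfig (Site d))}

/-- **FKG-lattice cylinder probabilities of the limit measure `φ^b_{p,q}`** (`0 ≤ p ≤ 1`, `q ≥ 1`): cylinders are local
events, so the finite-volume inequalities pass to the limit. [this work] -/
theorem isRandomClusterLimit_fkg_setCylinders (hP : IsRandomClusterLimit d b p q P) (hp : p ∈ Set.Icc (0 : ℝ) 1)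
    (hq : 1 ≤ q) (J : Finset (Sym2 (Site d))) (A B : Set (Sym2 (Site d))) :
    P.real {x | x ∩ ↑J = A ∩ ↑J} * P.real {x | x ∩ ↑J = B ∩ ↑J} ≤
      P.real {x | x ∩ ↑J = (A ∩ B) ∩ ↑J} * P.real {x | x ∩ ↑J = (A ∪ B) ∩ ↑J} :=
  le_of_tendsto_of_tendsto'
    ((hP.tendsto_real (isLocalEvent_setCylinder J A)).mul (hP.tendsto_real (isLocalEvent_setCylinder J B)))
    ((hP.tendsto_real (isLocalEvent_setCylinder J _)).mul (hP.tendsto_real (isLocalEvent_setCylinder J _)))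
    fun n => rcLaw_fkg_setCylinders hp hq (box d n) (b.wiredSet (box d n)) J A B

/-- **THE LIMIT RANDOM-CLUSTER MEASURES `φ^b_{p,q}` OF `ℤ^d` ARE BOX-TP₂** (`b` free or wired, `0 ≤ p ≤ 1`, `q ≥ 1`,
`d ≥ 1` in the form of an enumeration `e` of the pairs of sites). [this work] -/
theorem isRandomClusterLimit_isBoxTP2 (hP : IsRandomClusterLimit d b p q P) (hp : p ∈ Set.Icc (0 : ℝ) 1) (hq : 1 ≤ q)
    (e : Sym2 (Site d) ≃ ℕ) : IsBoxTP2 P := by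
  haveI := hP.isProbabilityMeasure
  exact isBoxTP2_of_fkg_setCylinders e P (isRandomClusterLimit_fkg_setCylinders hP hp hq)

variable {n : ℕ}

/-- **Given `∀ d', LiebSahiContinuum d' n` (⟺ `C_n`): the limit random-cluster measure `φ^b_{p,q}` is Sahi-positive of
order `n` for ALL measurable nonnegative monotone functionals** of the infinite bond configuration. [this work] -/
theorem isRandomClusterLimit_msahiE_nonneg (hP : IsRandomClusterLimit d b p q P) (hp : p ∈ Set.Icc (0 : ℝ) 1)
    (hq : 1 ≤ q) (e : Sym2 (Site d) ≃ ℕ) (hL : ∀ d', LiebSahiContinuum d' n) (f : Fin n → BondConfig (Site d) → ℝ)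
    (hfm : ∀ i, Measurable (f i)) (hf0 : ∀ i x, 0 ≤ f i x) (hmono : ∀ i, Monotone (f i)) : 0 ≤ msahiE P n f := by
  haveI := hP.isProbabilityMeasure
  exact msahiE_nonneg_of_isBoxTP2_set e hL P (isRandomClusterLimit_isBoxTP2 hP hp hq e) f hfm hf0 hmono

/-- Decreasing functionals. [this work] -/
theorem isRandomClusterLimit_msahiE_nonneg_antitone (hP : IsRandomClusterLimit d b p q P) (hp : p ∈ Set.Icc (0 : ℝ) 1)
    (hq : 1 ≤ q) (e : Sym2 (Site d) ≃ ℕ) (hL : ∀ d', LiebSahiContinuum d' n) (f : Fin n → BondConfig (Site d) → ℝ)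
    (hfm : ∀ i, Measurable (f i)) (hf0 : ∀ i x, 0 ≤ f i x) (hanti : ∀ i, Antitone (f i)) : 0 ≤ msahiE P n f := by
  haveI := hP.isProbabilityMeasure
  exact msahiE_nonneg_of_isBoxTP2_set_antitone e hL P (isRandomClusterLimit_isBoxTP2 hP hp hq e) f hfm hf0 hanti

/-- **`C_n` ⟹ Sahi positivity of order `n` of `φ^b_{p,q}`** (in particular FK–Ising, `q = 2`).
[this work; cite: Sahi2008, Conj. 5 (p. 212); LiebSahi2021, Conj. 1.1] -/
theorem isRandomClusterLimit_msahiE_nonneg_of_sahiConjecture (hP : IsRandomClusterLimit d b p q P)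
    (hp : p ∈ Set.Icc (0 : ℝ) 1) (hq : 1 ≤ q) (e : Sym2 (Site d) ≃ ℕ) (hC : SahiConjecture n)
    (f : Fin n → BondConfig (Site d) → ℝ) (hfm : ∀ i, Measurable (f i)) (hf0 : ∀ i x, 0 ≤ f i x)
    (hmono : ∀ i, Monotone (f i)) : 0 ≤ msahiE P n f :=
  isRandomClusterLimit_msahiE_nonneg hP hp hq e ((sahiConjecture_iff_forall_liebSahiContinuum n).1 hC) f hfm hf0 hmono

/-- **UNCONDITIONALLY: the FKG inequality for `φ^b_{p,q}` and ALL measurable nonnegative monotone functionals** of the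
infinite configuration (local or not). [this work] -/
theorem isRandomClusterLimit_integral_mul_integral_le (hP : IsRandomClusterLimit d b p q P) (hp : p ∈ Set.Icc (0 : ℝ) 1)
    (hq : 1 ≤ q) (e : Sym2 (Site d) ≃ ℕ) {f g : BondConfig (Site d) → ℝ} (hfm : Measurable f) (hgm : Measurable g)
    (hf0 : ∀ x, 0 ≤ f x) (hg0 : ∀ x, 0 ≤ g x) (hf : Monotone f) (hg : Monotone g) :
    (∫ x, f x ∂P) * (∫ x, g x ∂P) ≤ ∫ x, f x * g x ∂P := by
  haveI := hP.isProbabilityMeasure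
  exact integral_mul_integral_le_of_fkg_setCylinders e P (isRandomClusterLimit_fkg_setCylinders hP hp hq) hfm hgm hf0 hg0 hf hg

/-- **`φ^b_{p,q}` is positively associated** (the tree's `IsPositivelyAssociated`: all measurable increasing events).
[this work] -/
theorem isRandomClusterLimit_isPositivelyAssociated (hP : IsRandomClusterLimit d b p q P) (hp : p ∈ Set.Icc (0 : ℝ) 1)
    (hq : 1 ≤ q) (e : Sym2 (Site d) ≃ ℕ) : IsPositivelyAssociated P := by
  haveI := hP.isProbabilityMeasure
  refine isPositivelyAssociated_of_indicator P fun A B hA hB hAm hBm => ?_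
  obtain ⟨hAmono, hAmeas, hA0, -⟩ := indicator_one_props hA hAm
  obtain ⟨hBmono, hBmeas, hB0, -⟩ := indicator_one_props hB hBm
  exact isRandomClusterLimit_integral_mul_integral_le hP hp hq e hAmeas hBmeas hA0 hB0 hAmono hBmono

/-- **Increasing events are positively correlated under `φ^b_{p,q}`**: `φ(A) φ(B) ≤ φ(A ∩ B)` for all measurable
increasing events of the infinite configuration. [this work] -/
theorem isRandomClusterLimit_measure_mul_le_inter (hP : IsRandomClusterLimit d b p q P) (hp : p ∈ Set.Icc (0 : ℝ) 1)
    (hq : 1 ≤ q) (e : Sym2 (Site d) ≃ ℕ) {A B : Set (BondConfig (Site d))} (hA : IsUpperSet A) (hB : IsUpperSet B)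
    (hAm : MeasurableSet A) (hBm : MeasurableSet B) : P A * P B ≤ P (A ∩ B) :=
  (isRandomClusterLimit_isPositivelyAssociated hP hp hq e).mul_le_inter hA hB hAm hBm

/-- **Percolation events**: `φ(x ↔ ∞) φ(y ↔ ∞) ≤ φ(x ↔ ∞ and y ↔ ∞)` under `φ^b_{p,q}` — non-local increasing
events. [this work] -/
theorem isRandomClusterLimit_percolatesAt_mul_le (hP : IsRandomClusterLimit d b p q P) (hp : p ∈ Set.Icc (0 : ℝ) 1)
    (hq : 1 ≤ q) (e : Sym2 (Site d) ≃ ℕ) (x y : Site d) :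
    P (percolatesAt x) * P (percolatesAt y) ≤ P (percolatesAt x ∩ percolatesAt y) :=
  isRandomClusterLimit_measure_mul_le_inter hP hp hq e (isUpperSet_percolatesAt x) (isUpperSet_percolatesAt y)
    (measurableSet_percolatesAt_holds x) (measurableSet_percolatesAt_holds y)

end Limit

end Summit.CriticalPhenomena.PercolationContinuityZ3.Theorems.SahiBoxTP2
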